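import Literature.NumberTheory.Transcendental.AnalytificationLocalBiholomorphism
import HarnessLib

/-!
# Holomorphy descends through a holomorphic local homeomorphism into an analytification

Topic `Literature/NumberTheory/Transcendental`, namespace `Literature.NumberTheory.Transcendental` (grouping
sub-namespace `IsAnalytification`).  THEOREMS ONLY (no definition, no named fact, no instance, no `sorry`).

Companion of ★ `AnalytificationLocalBiholomorphism.lean`.  There, for an analytification `ψ : M' → Y(ℂ)` with
holomorphic atlas of a smooth `k`-scheme `Y` and a map `u : G ⊇ O → Y(ℂ)` from an open set of a finite-dimensional
complex vector space which is a local homeomorphism and holomorphic in algebraic coordinates (the shape in which the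
tree records the uniformisations `𝔹 → Γ\𝔹` and `𝔥_g → Γ_δ(N)\𝔥_g`), the lift `ũ = ψ⁻¹ ∘ u : O → M'` is shown to
be a holomorphic map with bijective differential (Clements–Osgood).  Here we record the consequence that is used to
READ HOLOMORPHY OF A MAP OUT OF `Y^an` ON THE UNIFORMISATION:

* `IsAnalytification.mdifferentiableAt_of_comp_eventuallyEq` — if `φ : M' → M''` is any map into a complex
  charted space and `φ ∘ ũ` agrees near `z ∈ O` with a map `g` holomorphic at `z`, then `φ` is holomorphic at
  `ũ z`.

Proof ([FritzscheGrauert2002] Ch. I §8 Thm. 8.5 / Cor. 8.6, «`f : G → f(G)` is biholomorphic»): in the chart `χ` of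
`M'` at `ũ z` the map `Y = χ ∘ ũ` is injective and holomorphic on an open neighbourhood `O'` of `z` between spaces of
the same dimension (★ `finrank_eq_of_isLocalHomeomorph_restrict`, Brouwer), so `Y(O')` is open and the inverse
`Y⁻¹ : Y(O') → O'` is holomorphic (★ `Literature.Analysis.Complex.SCV.isOpen_image_of_injOn`,
★ `…differentiableOn_symm_of_differentiableOn`); near `ũ z` one has `φ = g ∘ Y⁻¹ ∘ χ`, a composite of maps
holomorphic at the relevant points.  This is the converse companion of ★ `injective_mfderiv_of_eventuallyEq_comp`
(which reads the RANK of an already-holomorphic `φ` on the uniformisation).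

Consumer: the proof of fan-B row #61 `ShimuraVarieties.siegel_borel_extension` (cell hodgecm-mathlib, I-1′ line
`F1ExtHodgeType`): a point map out of a compact ball quotient with holomorphic Siegel lifts is holomorphic between the
analytifications, hence algebraic by GAGA (★ `arapura2012_cor_15_4_6_holds`).  HC_CM is proved only modulo the 7
printed citations until rung 0 closes; banked generic leaf, no floor change.

## References
* [FritzscheGrauert2002] K. Fritzsche, H. Grauert, *From Holomorphic Functions to Complex Manifolds*, GTM 213
  (2002), Ch. I §8 Thm. 8.5, Cor. 8.6; Ch. IV §1.
* [SerreGAGA1956] J.-P. Serre, *Géométrie algébrique et géométrie analytique*, Ann. Inst. Fourier 6 (1956), §2 n°6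
  Prop. 3 Cor. 2.
-/

noncomputable section

open Set Function Filter Topology AlgebraicGeometry
open scoped Manifold ContDiff

namespace Literature.NumberTheory.Transcendental

open Literature.AlgebraicGeometry.Motives (ComplexPoints AlgPoints SchemeOver)
open Literature.AlgebraicGeometry.Motives.AlgPoints

namespace IsAnalytification

variable {E' : Type*} [NormedAddCommGroup E'] [NormedSpace ℂ E'] [FiniteDimensional ℂ E']
  {M' : Type*} [TopologicalSpace M'] [ChartedSpace E' M']
  {G : Type*} [NormedAddCommGroup G] [NormedSpace ℂ G]
  {k : Type} [Field k] [Algebra k ℂ] {Y : SchemeOver k} {m : ℕ} {ψ : M' → ComplexPoints Y}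
  {E'' : Type*} [NormedAddCommGroup E''] [NormedSpace ℂ E''] {H'' : Type*} [TopologicalSpace H'']
  {I'' : ModelWithCorners ℂ E'' H''} {M'' : Type*} [TopologicalSpace M''] [ChartedSpace H'' M'']

/-- **Holomorphy is read on a uniformisation.**  Let `ψ : M' → Y(ℂ)` be an analytification with holomorphic atlas
of the smooth `k`-scheme `Y` of relative dimension `m`, `O ⊆ G` open in a finite-dimensional complex normed space,
and `u : G → Y(ℂ)` continuous-open-locally-injective on `O` (`O.restrict u` a local homeomorphism) and holomorphic
in algebraic coordinates on `O`.  If a map `φ : M' → M''` into a complex charted space satisfies `φ (ψ⁻¹ (u w)) = g w`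
for `w` near `z ∈ O`, with `g` holomorphic at `z`, then `φ` is holomorphic at `ψ⁻¹ (u z)`: the lift `ψ⁻¹ ∘ u` is a
local biholomorphism at `z` (Clements–Osgood), and `φ = g ∘ (ψ⁻¹ ∘ u)⁻¹` near `ψ⁻¹ (u z)`.
[cite: FritzscheGrauert2002, Ch. I §8 Thm. 8.5 and Cor. 8.6] [cite: SerreGAGA1956, §2 n°6 Prop. 3 Cor. 2] -/
theorem mdifferentiableAt_of_comp_eventuallyEq [FiniteDimensional ℂ G] [SmoothOfRelativeDimension m Y.hom]
    [IsManifold 𝓘(ℂ, E') ω M'] (hψ : IsAnalytification E' Y m ψ) {u : G → ComplexPoints Y}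
    {O : Set G} (hO : IsOpen O) (hloc : IsLocalHomeomorph (O.restrict u))
    (hhol : ∀ (U : Y.left.affineOpens) (s : Y.left.presheaf.obj (Opposite.op (↑U : Y.left.Opens))),
      DifferentiableOn ℂ (fun z ↦ evalOrZero (↑U : Y.left.Opens) s (u z))
        (O ∩ u ⁻¹' {P | P.pt ∈ (↑U : Y.left.Opens)}))
    {z : G} (hz : z ∈ O) {φ : M' → M''} {g : G → M''} (hg : MDifferentiableAt 𝓘(ℂ, G) I'' g z)
    (hcomm : ∀ᶠ w in 𝓝 z, φ (hψ.homeomorph.symm (u w)) = g w) :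
    MDifferentiableAt 𝓘(ℂ, E') I'' φ (hψ.homeomorph.symm (u z)) := by
  classical
  haveI : IsManifold 𝓘(ℂ, E') 1 M' := inferInstance
  have hcontO : ContinuousOn u O := by
    rw [continuousOn_iff_continuous_restrict]; exact hloc.continuous
  set Ψ := hψ.homeomorph with hΨ
  set ut : G → M' := Ψ.symm ∘ u with hut
  set x : M' := ut z with hx
  -- local injectivity of `u` near `z`
  obtain ⟨e, hze, he⟩ := hloc ⟨z, hz⟩
  set V₀ : Set G := Subtype.val '' e.source with hV₀
  have hV₀o : IsOpen V₀ := hO.isOpenMap_subtype_val _ e.open_source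
  have hV₀O : V₀ ⊆ O := Subtype.coe_image_subset O e.source
  have huinj : InjOn u V₀ := by
    rintro _ ⟨a, ha, rfl⟩ _ ⟨b, hb, rfl⟩ hab
    have : e a = e b := by
      rw [← he]; exact hab
    rw [e.injOn ha hb this]
  -- the open set on which `Yf = χ ∘ ũ` is injective and holomorphic
  set O' : Set G := V₀ ∩ ut ⁻¹' (chartAt E' x).source with hO'
  have hutc : ContinuousOn ut O := Ψ.symm.continuous.comp_continuousOn hcontO
  have hO'o : IsOpen O' := (hutc.mono hV₀O).isOpen_inter_preimage hV₀o (chartAt E' x).open_source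
  have hzO' : z ∈ O' := ⟨⟨⟨z, hz⟩, hze, rfl⟩, mem_chart_source E' x⟩
  have hO'O : O' ⊆ O := fun w hw ↦ hV₀O hw.1
  have hsrc : ∀ w ∈ O', ut w ∈ (extChartAt 𝓘(ℂ, E') x).source := fun w hw ↦ by
    rw [extChartAt_source]; exact hw.2
  set Yf : G → E' := fun w ↦ extChartAt 𝓘(ℂ, E') x (ut w) with hYf
  have hmd : ∀ w ∈ O, MDifferentiableAt 𝓘(ℂ, G) 𝓘(ℂ, E') ut w :=
    fun w hw ↦ hψ.mdifferentiableAt_symm_comp hO hcontO hhol hw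
  have hYd : DifferentiableOn ℂ Yf O' := by
    intro w hw
    have h1 := hmd w (hO'O hw)
    have h2 : MDifferentiableAt 𝓘(ℂ, E') 𝓘(ℂ, E') (extChartAt 𝓘(ℂ, E') x) (ut w) :=
      mdifferentiableAt_extChartAt hw.2
    exact (mdifferentiableAt_iff_differentiableAt.1 (h2.comp w h1)).differentiableWithinAt
  have hYinj : InjOn Yf O' := by
    intro a ha b hb hab
    have h1 : ut a = ut b := (extChartAt 𝓘(ℂ, E') x).injOn (hsrc a ha) (hsrc b hb) hab
    exact huinj ha.1 hb.1 (Ψ.symm.injective h1)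
  -- equal dimensions (Brouwer), so `Yf : O' → Yf(O')` is an open partial homeomorphism with holomorphic inverse
  have hdim : Module.finrank ℂ G = Module.finrank ℂ E' := by
    rw [hψ.finrank_eq_of_isLocalHomeomorph_restrict hO ⟨z, hz⟩ hloc, hψ.finrank_eq]
  haveI : Nonempty G := ⟨z⟩
  set eY : PartialEquiv G E' := hYinj.toPartialEquiv Yf O' with heY
  have hopen : IsOpenMap (O'.restrict Yf) := by
    intro s hs
    obtain ⟨V, hV, rfl⟩ := isOpen_induced_iff.1 hs
    have himg : O'.restrict Yf '' (Subtype.val ⁻¹' V) = Yf '' (O' ∩ V) := by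
      ext y
      constructor
      · rintro ⟨⟨w, hwO⟩, hwV, rfl⟩
        exact ⟨w, ⟨hwO, hwV⟩, rfl⟩
      · rintro ⟨w, ⟨hwO, hwV⟩, rfl⟩
        exact ⟨⟨w, hwO⟩, hwV, rfl⟩
    rw [himg]
    exact Literature.Analysis.Complex.SCV.isOpen_image_of_injOn hdim (hYd.mono inter_subset_left)
      (hO'o.inter hV) (hYinj.mono inter_subset_left)
  set T : OpenPartialHomeomorph G E' :=
    OpenPartialHomeomorph.ofContinuousOpenRestrict eY hYd.continuousOn hopen hO'o with hT
  have hTsrc : T.source = O' := rfl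
  have hTtgt : T.target = Yf '' O' := rfl
  have hTo : IsOpen T.target := T.open_target
  have hTd : DifferentiableOn ℂ T T.source := hYd
  have hTsymm : DifferentiableOn ℂ T.symm T.target :=
    Literature.Analysis.Complex.SCV.differentiableOn_symm_of_differentiableOn hdim T hTd
  have hzT : Yf z ∈ T.target := ⟨z, hzO', rfl⟩
  have hTz : T.symm (Yf z) = z := T.left_inv (show z ∈ T.source from hzO')
  -- the set of chart values where `φ ∘ χ⁻¹ = g ∘ T⁻¹`
  obtain ⟨N, hNnhds, hN⟩ : ∃ N ∈ 𝓝 z, ∀ w ∈ N, φ (ut w) = g w := by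
    obtain ⟨N, hN, hNin⟩ := Filter.Eventually.exists_mem hcomm
    exact ⟨N, hN, hNin⟩
  obtain ⟨N₀, hN₀N, hN₀o, hzN₀⟩ := mem_nhds_iff.1 hNnhds
  set W : Set E' := T.target ∩ T.symm ⁻¹' N₀ with hW
  have hWo : IsOpen W := T.isOpen_inter_preimage_symm hN₀o
  have hzW : Yf z ∈ W := ⟨hzT, by show T.symm (Yf z) ∈ N₀; rw [hTz]; exact hzN₀⟩
  -- `φ = g ∘ T⁻¹ ∘ χ` near `x`
  have hxchart : ContinuousAt (extChartAt 𝓘(ℂ, E') x) x := continuousAt_extChartAt x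
  have hpre : (extChartAt 𝓘(ℂ, E') x) ⁻¹' W ∈ 𝓝 x := hxchart.preimage_mem_nhds (hWo.mem_nhds hzW)
  have hsrcx : (chartAt E' x).source ∈ 𝓝 x := (chartAt E' x).open_source.mem_nhds (mem_chart_source E' x)
  have heq : φ =ᶠ[𝓝 x] (g ∘ T.symm ∘ extChartAt 𝓘(ℂ, E') x) := by
    filter_upwards [hpre, hsrcx] with x' hx'W hx'src
    obtain ⟨hyT, hyN⟩ := hx'W
    have hwO' : T.symm (extChartAt 𝓘(ℂ, E') x x') ∈ O' := T.map_target hyT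
    have hright : Yf (T.symm (extChartAt 𝓘(ℂ, E') x x')) = extChartAt 𝓘(ℂ, E') x x' := T.right_inv hyT
    have hx'src' : x' ∈ (extChartAt 𝓘(ℂ, E') x).source := by rw [extChartAt_source]; exact hx'src
    have hut_eq : ut (T.symm (extChartAt 𝓘(ℂ, E') x x')) = x' :=
      (extChartAt 𝓘(ℂ, E') x).injOn (hsrc _ hwO') hx'src' hright
    show φ x' = g (T.symm (extChartAt 𝓘(ℂ, E') x x'))
    rw [← hN _ (hN₀N hyN), hut_eq]
  refine (heq.mdifferentiableAt_iff).2 ?_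
  -- differentiability of the composite `g ∘ T⁻¹ ∘ χ` at `x`
  have h1 : MDifferentiableAt 𝓘(ℂ, E') 𝓘(ℂ, E') (extChartAt 𝓘(ℂ, E') x) x :=
    mdifferentiableAt_extChartAt (mem_chart_source E' x)
  have hxYf : extChartAt 𝓘(ℂ, E') x x = Yf z := rfl
  have h2 : MDifferentiableAt 𝓘(ℂ, E') 𝓘(ℂ, G) T.symm (extChartAt 𝓘(ℂ, E') x x) := by
    rw [hxYf]
    exact mdifferentiableAt_iff_differentiableAt.2 ((hTsymm _ hzT).differentiableAt (hTo.mem_nhds hzT))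
  have h3 : MDifferentiableAt 𝓘(ℂ, G) I'' g (T.symm (extChartAt 𝓘(ℂ, E') x x)) := by
    rw [hxYf, hTz]; exact hg
  exact h3.comp x (h2.comp x h1)

end IsAnalytification

end Literature.NumberTheory.Transcendental

end
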